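import Summits.BirchSwinnertonDyer.BirchSwinnertonDyer.Theorems.EisensteinPrimesBSDpOnCellCStubC2OfContinuousDisplay
import Summits.BirchSwinnertonDyer.Rank1Residual.X2.CellCBDPValueLZZRoadIoo
import HarnessLib

/-!
# Crux 4 `BSDpOnCellC` (stmt-BirchSwinnertonDyer-19034), line b1 v9: `stub_c2`, the crux at the PRE tier and the ψ-even
# door FROM THE CORRECTED TYPED LZZ INPUT `X2.LZZRoadInputIoo` by name (cell `bsd-eis`, seat `bsd-eis-cgshw` g15; RULING
# L43 (2) «COMMISSION (O2)-LZZ@3», kernel side, part 3 of 3, Ioo TWIN of p509973 per RULINGS L53 / L56 (1), (4))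

HONEST FRAMING (cell `bsd-eis`, run/shared/lean/pub/bsd-eis/): theorems only (composition); nothing booked; X2 stays
CONSTRUCTION-SHAPED; no label or count moves; BSD is not proved by any of this. Every theorem is CONDITIONAL on its displayed
binders: `X2.LZZRoadInputIoo` (a TYPED INPUT = Liu–Zhang–Zhang 2018 Thm. 3.8 ∧ 3.10 ∧ Prop. 4.12 = Duke 167 (2018) Thm.
3.2.10 ∧ 3.3.2 ∧ Prop. 4.3.4 on the modular curve at `p ‖ N` rendered in tree currency with flagged readings and the (L3′)
radius clause on the OPEN disc `0 < ρ < 1` (p512118) — NOT a Literature fact, NOT claimed printed in this currency; the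
typist's REFEREED fact `LiuZhangZhang2018.thm151_thm153_modularCurve_heegnerVector` (p509230, Duke §1.5) is to imply it:
`X2.lzzRoadInputIoo_of_thm151_thm153`, k5-c4, RULING L56 (2)), the 16 published named facts + [cas-split] (= v9
`stub_publishedFacts` VERBATIM), Keller–Yin Thm. D BY NAME (PREPRINT, gapped at L1754), and — for the whole cell only —
crux 3 `MazurMCOnCellB`. This file is p509973 (`…OfLZZRoad.lean`, doors from the superseded over-strong `X2.LZZRoadInput`)
RE-TARGETED: same three compositions, `X2.bdpValueContinuousDisplayAt_of_lzzRoadInputIoo` in place of `…_of_lzzRoadInput`.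

* `stub_c2_of_lzzRoadInputIoo` : `X2.LZZRoadInputIoo →` v9's `stub_c2` VERBATIM.
* `bsdpOnCellC_of_lzzRoadInputIoo_of_thmD_OPEN` : PUB(16)+[cas-split] + `LZZRoadInputIoo` + Thm D by name + crux 3 ⊢
  `BSDpOnCellC` (route decl BY NAME).
* **`bsdpOnCellCNotGV_of_lzzRoadInputIoo_of_thmD_OPEN`** : PUB(16)+[cas-split] + `LZZRoadInputIoo` + Thm D by name ⊢
  `∀ W p, CellC W p → ¬GVPar W p → BSDp W p` — NO crux 3, NO value atom. Census reading (no label moves here): on ALL ψ-even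
  B11 entries (9 981 @3 + 409 @5/@7, class-wide) crux 4's residue is {Keller–Yin Thm. D [PRE]} ∪ {`LZZRoadInputIoo`}; the day
  `X2.lzzRoadInputIoo_of_thm151_thm153` lands the second set is the REFEREED LZZ fact (+ its cited readings) and the
  reading is «literal on Thm D alone» (chain of record, RULING L56 (5)).

References: [LiuZhangZhang2018] Thm. 3.8, Thm. 3.10, Prop. 4.12 (arXiv:1511.08172 pp. 18, 23) = Duke Math. J. 167 (2018)
Thm. 3.2.10, Thm. 3.3.2, Prop. 4.3.4; [KellerYin2024] Thm. D = Thm. 5.1.3 (PRE); [Castella2018Exceptional] Thms. 2.10–2.11;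
[Hsieh2014] Thm. 1; [GreenbergVatsal2000] Thm. (1.3); [CastellaEtAl2021] Thm. 5.3.1; [Miller2011LMS] Def. 1.1; RULINGS
L11 / L43 / L53 / L56; c2v MEMO-1/2; cgshw MEMO-18.
-/

set_option autoImplicit false
set_option linter.dupNamespace false

noncomputable section

open scoped Classical MatrixGroups ModularForm

open CongruenceSubgroup WeierstrassCurve NumberField IsDedekindDomain Field PowerSeries
  Literature.NumberTheory.EllipticCurves Literature.NumberTheory.EllipticCurves.GreenbergSelmer
  Literature.NumberTheory.EllipticCurves.ModularForms Literature.NumberTheory.QuadraticFields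
  Literature.NumberTheory.EllipticCurves.Rank1Residual
  Literature.NumberTheory.EllipticCurves.Rank1Residual.Typed
  Literature.NumberTheory.EllipticCurves.GreenbergVatsal2000
  Literature.NumberTheory.EllipticCurves.Wuthrich2014
  Literature.NumberTheory.EllipticCurves.SteinWuthrich2013
  Literature.NumberTheory.EllipticCurves.Castella2018Exceptional
  Literature.NumberTheory.GaloisRepresentations Literature.NumberTheory.GaloisCohomology
  Literature.NumberTheory.Automorphic
  Summit.BirchSwinnertonDyer.Rank1Residual.X11b.AcSelmer
  Summit.BirchSwinnertonDyer.Rank1Residual.X11b.Halves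
  Summit.BirchSwinnertonDyer.Rank1Residual.X11b
  Summit.BirchSwinnertonDyer.Rank1Residual.X2
  Summit.BirchSwinnertonDyer.Rank1Residual

namespace Summit.BirchSwinnertonDyer.BirchSwinnertonDyer.Theorems.Reoriented

/-- **v9's `stub_c2` VERBATIM from the corrected typed LZZ input (Ioo twin of p509973).** `X2.bdpValueContinuousDisplayAt_of_lzzRoadInputIoo` at `p = 3`
(the kernel rescale of `X2/CellCBDPValueLZZRoadIoo.lean`), then `stub_c2_of_continuousDisplay_three`. CONDITIONAL on
`X2.LZZRoadInputIoo` (typed input; NOT in print in this currency); nothing booked.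
[cite: LiuZhangZhang2018, Thm. 3.8 and Thm. 3.10 and Prop. 4.12 (arXiv:1511.08172 pp. 18, 23) (source of the input; nothing asserted)] -/
theorem stub_c2_of_lzzRoadInputIoo (hL : X2.LZZRoadInputIoo) :
    (∀ (W : WeierstrassCurve ℚ) [W.IsElliptic] [W.IsGloballyMinimal] (p : ℕ) [Fact p.Prime],
        p = 3 → CellC W p → ¬ W.HasSplitMultiplicativeReductionAtPrime p → NonsplitBDPValueOnTreeInt W p) ∧
      (∀ (W : WeierstrassCurve ℚ) [W.IsElliptic] [W.IsGloballyMinimal] (p : ℕ) [Fact p.Prime],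
        p = 3 → CellC W p → W.HasSplitMultiplicativeReductionAtPrime p → SplitBDPValueOnTreeInt W p) :=
  stub_c2_of_continuousDisplay_three fun W _ _ ↦ X2.bdpValueContinuousDisplayAt_of_lzzRoadInputIoo hL W 3

/-- **Crux 4 `BSDpOnCellC` AT THE PRE TIER with the value atom from the typed LZZ input:** from the 16 published facts +
[cas-split] (`hPub`), `X2.LZZRoadInputIoo` (`hL`), Keller–Yin Thm. D BY NAME (`hD`, PREPRINT, gapped) and crux 3 (`hMCB`).
= `bsdpOnCellC_of_continuousDisplay_three_of_thmD_OPEN` ∘ `X2.bdpValueContinuousDisplayAt_of_lzzRoadInputIoo`. A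
`conditional-result`: credits nothing, books nothing.
[claim: KellerYin2024, status: under-review] [cite: KellerYin2024, Thm. D = Thm. 5.1.3 (arXiv:2402.12781v2 L306–L309)]
[cite: LiuZhangZhang2018, Thm. 3.8 and Thm. 3.10 and Prop. 4.12 (arXiv:1511.08172 pp. 18, 23) (source of the input; nothing asserted)]
[cite: Castella2018Exceptional, Thm. 2.10 and Thm. 2.11 (arXiv:1507.04260 pp. 13–14)]
[cite: Hsieh2014, Thm. 1 (arXiv:1112.1580 pp. 3–4)] [cite: CastellaEtAl2021, Thm. 5.3.1] [cite: Miller2011LMS, Def. 1.1] -/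
theorem bsdpOnCellC_of_lzzRoadInputIoo_of_thmD_OPEN
    (hPub : (lambdaMu_multiplicative_of_gvPar ∧ thm16_charIdeal_dvd_multiplicative_of_reducible ∧
      thm61_splitMultiplicative ∧ thm61_nonsplitMultiplicative ∧
      (∀ (W : WeierstrassCurve ℚ) [W.IsElliptic] [W.IsGloballyMinimal] (p : ℕ) [Fact p.Prime],
        greenberg_stevens (W := W) (p := p)) ∧
      exists_isNewformOf ∧
      (∀ (K : Type) [Field K] [NumberField K], poitouTate_selmerStructure_duality K) ∧
      (∀ (K : Type) [Field K] [NumberField K], poitouTate_sha_tateDual K) ∧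
      hsieh2014_exists_anticyclotomicPAdicLFunction ∧
      (∀ (N : ℕ) [NeZero N] (W : WeierstrassCurve ℚ) (K : Type) [Field K] [NumberField K],
        gross_zagier N W K) ∧
      (∀ (N : ℕ) [NeZero N] (W : WeierstrassCurve ℚ) (K : Type) [Field K] [NumberField K],
        kolyvagin N W K) ∧
      rank_eq_analyticRank_of_analyticRank_le_one ∧ HoffsteinLuo1997_exists_twist_L_one_ne_zero ∧
      mazur_not_dvd_maninConstant_of_odd ∧ bsdRHS_eq_of_isIsogenous) ∧
      thm210_thm211_bdpDisplay_pNew)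
    (hL : X2.LZZRoadInputIoo)
    (hD : KellerYin2024.thmD_imcMult_exists_isBDPLFunction_isTorsion_charIdeal_eq_OPEN)
    (hMCB : Summit.BirchSwinnertonDyer.BirchSwinnertonDyer.Theses.EisensteinPrimes.MazurMCOnCellB) :
    Summit.BirchSwinnertonDyer.BirchSwinnertonDyer.Theses.EisensteinPrimes.BSDpOnCellC :=
  bsdpOnCellC_of_continuousDisplay_three_of_thmD_OPEN hPub
    (fun W _ _ ↦ X2.bdpValueContinuousDisplayAt_of_lzzRoadInputIoo hL W 3) hD hMCB

/-- **The ψ-EVEN DOOR at every odd `p` with the value atom from the typed LZZ input: `CellC ∩ {¬GVPar} ⇒ BSD(E,p)`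
from the 16 published facts + [cas-split] (`hPub`), `X2.LZZRoadInputIoo` (`hL`) and Keller–Yin Thm. D BY NAME (`hD`) — NO
crux 3, NO value atom.** = `bsdpOnCellCNotGV_of_continuousDisplay_three_of_thmD_OPEN` ∘
`X2.bdpValueContinuousDisplayAt_of_lzzRoadInputIoo`. Census reading (no label moves here): every ψ-even B11 entry (9 981 @3 +
409 @5/@7 class-wide) reads {Thm. D [PRE]} ∪ {`LZZRoadInputIoo` [typed reading of LZZ18 (PUB) + Collins Thm. 5 + YZZ13 §1.6 +
CNF]} by this name; «literal on Thm D alone» the day `X2.lzzRoadInputIoo_of_thm151_thm153` lands. A `conditional-result`.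
[claim: KellerYin2024, status: under-review] [cite: KellerYin2024, Thm. D = Thm. 5.1.3 (arXiv:2402.12781v2 L306–L309)]
[cite: LiuZhangZhang2018, Thm. 3.8 and Thm. 3.10 and Prop. 4.12 (arXiv:1511.08172 pp. 18, 23) (source of the input; nothing asserted)]
[cite: GreenbergVatsal2000, Thm. (1.3) and §2 p. 28] [cite: Hsieh2014, Thm. 1 (arXiv:1112.1580 pp. 3–4)]
[cite: CastellaEtAl2021, Thm. 5.3.1] [cite: Miller2011LMS, Def. 1.1] -/
theorem bsdpOnCellCNotGV_of_lzzRoadInputIoo_of_thmD_OPEN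
    (hPub : (lambdaMu_multiplicative_of_gvPar ∧ thm16_charIdeal_dvd_multiplicative_of_reducible ∧
      thm61_splitMultiplicative ∧ thm61_nonsplitMultiplicative ∧
      (∀ (W : WeierstrassCurve ℚ) [W.IsElliptic] [W.IsGloballyMinimal] (p : ℕ) [Fact p.Prime],
        greenberg_stevens (W := W) (p := p)) ∧
      exists_isNewformOf ∧
      (∀ (K : Type) [Field K] [NumberField K], poitouTate_selmerStructure_duality K) ∧
      (∀ (K : Type) [Field K] [NumberField K], poitouTate_sha_tateDual K) ∧
      hsieh2014_exists_anticyclotomicPAdicLFunction ∧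
      (∀ (N : ℕ) [NeZero N] (W : WeierstrassCurve ℚ) (K : Type) [Field K] [NumberField K],
        gross_zagier N W K) ∧
      (∀ (N : ℕ) [NeZero N] (W : WeierstrassCurve ℚ) (K : Type) [Field K] [NumberField K],
        kolyvagin N W K) ∧
      rank_eq_analyticRank_of_analyticRank_le_one ∧ HoffsteinLuo1997_exists_twist_L_one_ne_zero ∧
      mazur_not_dvd_maninConstant_of_odd ∧ bsdRHS_eq_of_isIsogenous) ∧
      thm210_thm211_bdpDisplay_pNew)
    (hL : X2.LZZRoadInputIoo)
    (hD : KellerYin2024.thmD_imcMult_exists_isBDPLFunction_isTorsion_charIdeal_eq_OPEN) :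
    ∀ (W : WeierstrassCurve ℚ) [W.IsElliptic] [W.IsGloballyMinimal] (p : ℕ) [Fact p.Prime],
      CellC W p → ¬ GVPar W p → BSDp W p :=
  bsdpOnCellCNotGV_of_continuousDisplay_three_of_thmD_OPEN hPub
    (fun W _ _ ↦ X2.bdpValueContinuousDisplayAt_of_lzzRoadInputIoo hL W 3) hD

end Summit.BirchSwinnertonDyer.BirchSwinnertonDyer.Theorems.Reoriented

end
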